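import Summits.NavierStokesRegularity.FluidComputer.PalasekTowerLundgrenChildEntropyClock
import Literature.Analysis.FluidPDE.PlanarVorticityEntropyVelocity

/-!
# REGISTER v2.3″ (continued): THE SPEED FACE OF THE ENTROPY CLOCK — the swirl of a Lundgren-carried
# child with ANY positive log-tame cross-section relaxes, uniformly in space, to the Burgers swirl field
# at the rate `e^{−λA_k s/4}`: `‖swirl(s, y) − swirl_Burgers(y)‖ ≤ 0.52 (2H₀/Γ)^{1/4} e^{−λA_k s/4} · Γ (λA_k)^{1/2}`

Cell `ns-blowup`, seat `ns-blowup-ecbridge-8` (g9); evidence toward crux 19250 `HeredityFromTwo` of route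
`PalasekTowerBreakdown` (its SPEED face: `stub_speed_floors` / `SpeedFloorAt k`, and the speed part of
`WindowCeilingAt k`), in the MODEL lane «child core = cross-section of Lundgren's stretched flow in the
host strain `c = λA_k` at `ν = 1`». Same setting and hypotheses as `PalasekTowerLundgrenChildEntropyClock`
(the cross-section is a classical unforced planar Navier–Stokes run `ṽ = K₂ ∗ ω̃` on a convex planar-time
set `S'`, uniformly rapidly decaying, POSITIVE and LOG-TAME, `0 ∈ S'`, circulation `Γ = ∫ ω̃(0)`,
relative entropy `H₀ = H(0)` with respect to the Gaussian of mass `Γ` and virtual origin `c⁻¹`).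

What the entropy clock gave so far is an `L¹` statement (`…_anyProfile_L1_clock`:
`‖ω̃(τ(s)) − g_{τ(s)}‖₁ ≤ (2ΓH₀)^{1/2} e^{−cs/2}`). The register's speed face reads the SUP NORM of the
swirl. The bridge is kinematic (Literature `PlanarVorticityEntropyVelocity`): Majda–Bertozzi (8.27) for a
difference, `‖K₂ ∗ (ω̃ − g)‖_∞ ≤ ((‖ω̃‖_∞ + ‖g‖_∞) ‖ω̃ − g‖₁ / 2π)^{1/2}`, the tree's explicit any-profile
ceiling `‖ω̃(τ)‖_∞ ≤ Γ/τ`, and the dilation covariance of the Biot–Savart law, under which the Lundgren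
image `e^{cs/2} (K₂ ∗ g_{τ(s)})(e^{cs/2} y)` of the Lamb–Oseen field is the STEADY Biot–Savart swirl of
the Burgers cross-section `burgersVorticity c 1 Γ` (`lundgren_biotSavart2D_gaussian_eq_burgersSwirl`).

* `lundgren_biotSavart2D_gaussian_eq_burgersSwirl` — the dictionary entry just described;
* `palasekTowerBreakdown_anyProfile_childSwirl_relaxation` — for `s > 0` with `τ(s) ∈ S'` and every `y`:
  `‖e^{cs/2} ṽ(τ(s), e^{cs/2} y) − (K₂ ∗ ω_B)(y)‖ ≤ e^{cs/2} ((Γ/τ(s) + Γ/(4π(τ(s) + c⁻¹))) (2ΓH₀)^{1/2} e^{−cs/2} / 2π)^{1/2}`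
  (`ω_B(y) = burgersVorticity c 1 Γ (ι y)`);
* `palasekTowerBreakdown_anyProfile_childSwirl_relaxation_after_one_strain_time` — once `cs ≥ 1`:
  **`‖swirl(s, y) − (K₂ ∗ ω_B)(y)‖ ≤ 0.52 · (Γc)^{1/2} · (2ΓH₀)^{1/4} · e^{−cs/4}`**
  (`1/(1 − e^{−1}) ≤ (63/50)²`, `1/(4π) ≤ 0.08`, `(1.6676/2π)^{1/2} ≤ 0.52`);
* `palasekTowerBreakdown_anyProfile_childSwirl_relaxation_threshold` — for `δ > 0`, once moreover
  `0.52 (2ΓH₀)^{1/4} ≤ δ Γ^{1/2} e^{cs/4}` (i.e. after `s·λA_k ≥ log(0.1462·H₀/Γ) + 4 log(1/δ)` strain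
  times): **`‖swirl(s, y) − (K₂ ∗ ω_B)(y)‖ ≤ δ · Γ (λA_k)^{1/2}`**.

REGISTER READING. `Γ(λA_k)^{1/2}` is the natural swirl unit of the child (the Burgers swirl peaks at
`≈ 0.0508·Γ c^{1/2}` at `ν = 1`; g8's uniform any-profile ceiling is `0.3556·Γ c^{1/2}` after one strain
time, `…CeilingNumeric`). With `H₀ = Γ` and `δ = 0.005` (a tenth of the Burgers peak) the threshold is
`s·λA_k ≥ 19.3` strain times — inside the wide `k = 2` window. So on the SPEED face, too, the any-profile
class collapses onto the Burgers numbers at an explicit exponential rate; what is NOT typed here is the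
closed form `K₂ ∗ ω_B = Γ(2πr²)⁻¹(1 − e^{−cr²/4}) y^⊥` (the radial Biot–Savart evaluation is not in the
tree), positivity/log-tameness of the cross-section (hypotheses), and anything about sign-changing
cross-sections.

## References
* [cite: GallayWayne2005, §3.4 (arXiv:math/0402449 p. 14) and §1 (p. 4, similarity variables)]
* [cite: MajdaBertozziCUP2002, §8.2.3 Prop. 8.2 (i) (8.27) (held text p. 275)]
* [cite: Saffman1992, §13.3 eqs. (26), (29) (Lundgren's transformation)]
-/

noncomputable section

namespace Summit.NavierStokesRegularity.FluidComputer.PalasekTowerClayBridge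

open Real Set MeasureTheory
open Literature.Analysis.FluidPDE Literature.Analysis.FluidPDE.Lundgren

variable {S' : Set ℝ}
  {v : ℝ → EuclideanSpace ℝ (Fin 2) → EuclideanSpace ℝ (Fin 2)}
  {q : ℝ → EuclideanSpace ℝ (Fin 2) → ℝ}

namespace SwirlRelaxation

/-- The unforced planar run has curl-free (zero) force. [folklore] -/
theorem planarVorticity_zero_force (σ : ℝ) (η : EuclideanSpace ℝ (Fin 2)) :
    PlanarEigenmode.vorticity ((0 : ℝ → EuclideanSpace ℝ (Fin 2) → EuclideanSpace ℝ (Fin 2)) σ) η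
      = 0 := by
  rw [Pi.zero_apply, PlanarEigenmode.vorticity_def,
    show (0 : EuclideanSpace ℝ (Fin 2) → EuclideanSpace ℝ (Fin 2)) = fun _ => 0 from rfl]
  simp

/-- Lundgren's clock with the virtual origin `1/c`: `(e^{cs} − 1)/c + c⁻¹ = e^{cs}/c`. [folklore] -/
theorem clock_add_inv {c : ℝ} (hc : c ≠ 0) (s : ℝ) :
    (exp (c * s) - 1) / c + c⁻¹ = exp (c * s) / c := by
  field_simp
  ring

/-- `c⁻¹ / (e^{cs}/c) = e^{−cs}`. [folklore] -/
theorem inv_div_clock {c : ℝ} (hc : c ≠ 0) (s : ℝ) :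
    c⁻¹ / (exp (c * s) / c) = exp (-(c * s)) := by
  rw [Real.exp_neg]
  field_simp

/-- `√(e^{−cs}) = e^{−cs/2}`. [folklore] -/
theorem sqrt_exp_neg (c s : ℝ) : Real.sqrt (exp (-(c * s))) = exp (-(c * s / 2)) := by
  have h : exp (-(c * s)) = exp (-(c * s / 2)) ^ 2 := by
    rw [sq, ← Real.exp_add]; ring_nf
  rw [h, Real.sqrt_sq (exp_pos _).le]

/-- `(1 − e^{−x})⁻¹ ≤ (63/50)²` for `x ≥ 1`. [folklore] -/
theorem inv_one_sub_exp_neg_le {x : ℝ} (hx : 1 ≤ x) : (1 - exp (-x))⁻¹ ≤ (63 / 50) ^ 2 := by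
  have h1 : exp (-x) ≤ exp (-1) := exp_le_exp.2 (by linarith)
  have h2 : exp (-1) < 0.3678794412 := exp_neg_one_lt_d9
  have hpos : 0 < 1 - exp (-x) := by linarith
  rw [inv_le_comm₀ hpos (by norm_num)]
  norm_num at h2 ⊢
  linarith

/-- `1/(4π) ≤ 0.08`. [folklore] -/
theorem inv_four_pi_le : (4 * π)⁻¹ ≤ 0.08 := by
  have hπ : 3.141592 < π := pi_gt_d6
  rw [inv_le_comm₀ (by positivity) (by norm_num)]
  norm_num
  linarith

/-- `(1.6676/(2π))^{1/2} ≤ 0.52`. [folklore] -/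
theorem sqrt_const_le : Real.sqrt (1.6676 / (2 * π)) ≤ 0.52 := by
  have hπ : 3.141592 < π := pi_gt_d6
  rw [show (0.52 : ℝ) = Real.sqrt (0.52 ^ 2) by rw [Real.sqrt_sq (by norm_num)]]
  refine Real.sqrt_le_sqrt ?_
  rw [div_le_iff₀ (by positivity)]
  norm_num
  nlinarith

end SwirlRelaxation

open SwirlRelaxation

/-! ### §1 The dictionary: Lundgren's image of the Lamb–Oseen field is the Burgers swirl field -/

/-- **THE DICTIONARY (velocity)**: at constant rate `c ≠ 0` (`a = e^{cs/2}`, `τ = (e^{cs} − 1)/c`),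
Lundgren's image `a (K₂ ∗ g_τ)(a y)` of the Lamb–Oseen velocity field of the spreading Gaussian
`g_τ = Γ(4π(τ + c⁻¹))⁻¹ e^{−‖η‖²/(4(τ + c⁻¹))}` is, for EVERY `s`, the Biot–Savart swirl of the steady
Burgers cross-section `y ↦ burgersVorticity c 1 Γ (ι y)` — dilation covariance of `K₂`
(`smul_biotSavart2D_smul_eq`) and `burgersVorticity_eq_lundgren_gaussian`.
[cite: GallayWayne2005, §1 (arXiv p. 4, similarity variables); Saffman1992, §13.3 eqs. (26), (29)] -/
theorem lundgren_biotSavart2D_gaussian_eq_burgersSwirl {c : ℝ} (hc : c ≠ 0) (Γ s : ℝ)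
    (y : EuclideanSpace ℝ (Fin 2)) :
    exp (c * s / 2) • biotSavart2D (fun η =>
        Γ / (4 * π * ((exp (c * s) - 1) / c + c⁻¹)) *
          exp (-(‖η‖ ^ 2 / (4 * ((exp (c * s) - 1) / c + c⁻¹))))) (exp (c * s / 2) • y) =
      biotSavart2D (fun y' => burgersVorticity c 1 Γ (embedXY y')) y := by
  rw [smul_biotSavart2D_smul_eq _ (exp_pos _).ne']
  congr 1
  funext y'
  have e : embedXY y' = embedXY y' + (0 : ℝ) • eZ := by rw [zero_smul, add_zero]
  rw [e, burgersVorticity_eq_lundgren_gaussian hc Γ s 0 y']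

/-! ### §2 The swirl relaxes to the Burgers swirl field, uniformly in space -/

/-- **THE SPEED FACE OF THE ENTROPY CLOCK** (`ν = 1`, host strain `c = λA_k`; MODEL lane; setting of
`palasekTowerBreakdown_anyProfile_L1_clock`). For every strain time `s > 0` whose Lundgren time
`τ(s) = (e^{cs} − 1)/c` lies in `S'` and every `y`:
`‖e^{cs/2} ṽ(τ(s), e^{cs/2} y) − (K₂ ∗ ω_B)(y)‖ ≤ e^{cs/2} ((Γ/τ(s) + Γ/(4π(τ(s) + c⁻¹))) · (2ΓH₀)^{1/2} e^{−cs/2} / 2π)^{1/2}`,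
`ω_B(y) = burgersVorticity c 1 Γ (ι y)` — `IsClassicalNSSolutionOn.norm_sub_biotSavart2D_gaussian_le` at
`t₀ = 0`, `t⋆ = c⁻¹`, read through Lundgren's map and §1.
[cite: GallayWayne2005, §3.4; MajdaBertozziCUP2002, §8.2.3 (8.27); Saffman1992, §13.3 eq. (29)] -/
theorem palasekTowerBreakdown_anyProfile_childSwirl_relaxation (R : TowerRates) (k : ℕ)
    {l : ℝ} (hl : 0 < l) (hS' : Convex ℝ S') (hv : IsClassicalNSSolutionOn S' 1 0 v q)
    (hω : HasUniformRapidDecayOn S' (fun σ η => PlanarEigenmode.vorticity (v σ) η))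
    (hBS : ∀ σ ∈ S', ∀ η, v σ η = biotSavart2D (PlanarEigenmode.vorticity (v σ)) η)
    (hpos : ∀ σ ∈ S', ∀ η, 0 < PlanarEigenmode.vorticity (v σ) η) {L : ℝ} {m : ℕ}
    (hlog : ∀ σ ∈ S', ∀ η, |Real.log (PlanarEigenmode.vorticity (v σ) η)| ≤ L * (1 + ‖η‖) ^ m)
    (hsc : ∀ σ ∈ S', ∀ η, ‖fderiv ℝ (PlanarEigenmode.vorticity (v σ)) η‖ ≤
      L * (1 + ‖η‖) ^ m * PlanarEigenmode.vorticity (v σ) η)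
    (h0 : (0 : ℝ) ∈ S') {s : ℝ} (hs : 0 < s)
    (hτs : (exp (l * R.A k * s) - 1) / (l * R.A k) ∈ S') (y : EuclideanSpace ℝ (Fin 2)) :
    ‖exp (l * R.A k * s / 2) • v ((exp (l * R.A k * s) - 1) / (l * R.A k)) (exp (l * R.A k * s / 2) • y) -
        biotSavart2D (fun y' => burgersVorticity (l * R.A k) 1
          (∫ η, PlanarEigenmode.vorticity (v 0) η) (embedXY y')) y‖ ≤
      exp (l * R.A k * s / 2) *
        Real.sqrt (((∫ η, PlanarEigenmode.vorticity (v 0) η) / ((exp (l * R.A k * s) - 1) / (l * R.A k)) +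
            (∫ η, PlanarEigenmode.vorticity (v 0) η) /
              (4 * π * ((exp (l * R.A k * s) - 1) / (l * R.A k) + (l * R.A k)⁻¹))) *
          (Real.sqrt (2 * (∫ η, PlanarEigenmode.vorticity (v 0) η) *
              ∫ η, PlanarEigenmode.vorticity (v 0) η *
                Real.log (PlanarEigenmode.vorticity (v 0) η /
                  ((∫ y, PlanarEigenmode.vorticity (v 0) y) / (4 * π * (l * R.A k)⁻¹) *
                    exp (-(‖η‖ ^ 2 / (4 * (l * R.A k)⁻¹)))))) *
            exp (-(l * R.A k * s / 2))) / (2 * π)) := by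
  set c : ℝ := l * R.A k with hc
  have hcpos : 0 < c := mul_pos hl (R.A_pos k)
  set Γ : ℝ := ∫ η, PlanarEigenmode.vorticity (v 0) η with hΓ
  have hcurl : ∀ σ ∈ S', ∀ η, PlanarEigenmode.vorticity
      ((0 : ℝ → EuclideanSpace ℝ (Fin 2) → EuclideanSpace ℝ (Fin 2)) σ) η = 0 :=
    fun σ _ η => planarVorticity_zero_force σ η
  have hτpos : (0 : ℝ) < (exp (c * s) - 1) / c :=
    div_pos (by linarith [Real.add_one_lt_exp (mul_pos hcpos hs).ne', mul_pos hcpos hs]) hcpos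
  -- the planar sup-relaxation at `t₀ = 0`, `t⋆ = c⁻¹`, at the point `η = e^{cs/2} y`
  have h := hv.norm_sub_biotSavart2D_gaussian_le hS' one_pos hω hBS hcurl hpos hlog hsc h0 hτs hτpos
    (tstar := c⁻¹) (inv_pos.2 hcpos) (exp (c * s / 2) • y)
  simp only [mul_one, one_mul, sub_zero] at h
  -- the comparison field is the Burgers swirl field (§1)
  rw [← lundgren_biotSavart2D_gaussian_eq_burgersSwirl hcpos.ne' Γ s y, ← smul_sub, norm_smul,
    Real.norm_eq_abs, abs_of_pos (exp_pos _)]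
  refine mul_le_mul_of_nonneg_left (h.trans (le_of_eq ?_)) (exp_pos _).le
  rw [mul_div_assoc (2 * Γ * _) c⁻¹, clock_add_inv hcpos.ne', inv_div_clock hcpos.ne',
    Real.sqrt_mul' _ (exp_pos _).le, sqrt_exp_neg]

/-- **AFTER ONE STRAIN TIME: `‖swirl(s, y) − (K₂ ∗ ω_B)(y)‖ ≤ 0.52 · (Γc)^{1/2} (2ΓH₀)^{1/4} e^{−cs/4}`**
(same setting; `cs ≥ 1`): the explicit ceiling `Γ/τ(s) = Γc e^{−cs}/(1 − e^{−cs}) ≤ (63/50)² Γc e^{−cs}`,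
`Γ/(4π(τ + c⁻¹)) = Γc e^{−cs}/(4π) ≤ 0.08 Γc e^{−cs}`, and `(1.6676/2π)^{1/2} ≤ 0.52`. In the swirl unit
`Γ c^{1/2}` of the child this reads `0.52 (2H₀/Γ)^{1/4} e^{−λA_k s/4}`.
[cite: GallayWayne2005, §3.4; MajdaBertozziCUP2002, §8.2.3 (8.27)] -/
theorem palasekTowerBreakdown_anyProfile_childSwirl_relaxation_after_one_strain_time (R : TowerRates)
    (k : ℕ) {l : ℝ} (hl : 0 < l) (hS' : Convex ℝ S') (hv : IsClassicalNSSolutionOn S' 1 0 v q)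
    (hω : HasUniformRapidDecayOn S' (fun σ η => PlanarEigenmode.vorticity (v σ) η))
    (hBS : ∀ σ ∈ S', ∀ η, v σ η = biotSavart2D (PlanarEigenmode.vorticity (v σ)) η)
    (hpos : ∀ σ ∈ S', ∀ η, 0 < PlanarEigenmode.vorticity (v σ) η) {L : ℝ} {m : ℕ}
    (hlog : ∀ σ ∈ S', ∀ η, |Real.log (PlanarEigenmode.vorticity (v σ) η)| ≤ L * (1 + ‖η‖) ^ m)
    (hsc : ∀ σ ∈ S', ∀ η, ‖fderiv ℝ (PlanarEigenmode.vorticity (v σ)) η‖ ≤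
      L * (1 + ‖η‖) ^ m * PlanarEigenmode.vorticity (v σ) η)
    (h0 : (0 : ℝ) ∈ S') {s : ℝ} (hs1 : 1 ≤ l * R.A k * s)
    (hτs : (exp (l * R.A k * s) - 1) / (l * R.A k) ∈ S') (y : EuclideanSpace ℝ (Fin 2)) :
    ‖exp (l * R.A k * s / 2) • v ((exp (l * R.A k * s) - 1) / (l * R.A k)) (exp (l * R.A k * s / 2) • y) -
        biotSavart2D (fun y' => burgersVorticity (l * R.A k) 1
          (∫ η, PlanarEigenmode.vorticity (v 0) η) (embedXY y')) y‖ ≤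
      0.52 * Real.sqrt ((∫ η, PlanarEigenmode.vorticity (v 0) η) * (l * R.A k)) *
        Real.sqrt (Real.sqrt (2 * (∫ η, PlanarEigenmode.vorticity (v 0) η) *
          ∫ η, PlanarEigenmode.vorticity (v 0) η *
            Real.log (PlanarEigenmode.vorticity (v 0) η /
              ((∫ y, PlanarEigenmode.vorticity (v 0) y) / (4 * π * (l * R.A k)⁻¹) *
                exp (-(‖η‖ ^ 2 / (4 * (l * R.A k)⁻¹))))))) *
        exp (-(l * R.A k * s / 4)) := by
  set c : ℝ := l * R.A k with hc
  have hcpos : 0 < c := mul_pos hl (R.A_pos k)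
  have hs : 0 < s := by
    by_contra hneg
    rw [not_lt] at hneg
    have : c * s ≤ 0 := mul_nonpos_of_nonneg_of_nonpos hcpos.le hneg
    linarith
  set Γ : ℝ := ∫ η, PlanarEigenmode.vorticity (v 0) η with hΓ
  have hΓ0 : 0 ≤ Γ := integral_nonneg fun η => (hpos 0 h0 η).le
  set Q : ℝ := Real.sqrt (2 * Γ * ∫ η, PlanarEigenmode.vorticity (v 0) η *
    Real.log (PlanarEigenmode.vorticity (v 0) η /
      (Γ / (4 * π * c⁻¹) * exp (-(‖η‖ ^ 2 / (4 * c⁻¹)))))) with hQ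
  have hQ0 : 0 ≤ Q := Real.sqrt_nonneg _
  have h := palasekTowerBreakdown_anyProfile_childSwirl_relaxation R k hl hS' hv hω hBS hpos hlog hsc h0
    hs hτs y
  refine h.trans ?_
  -- Step 1: the two `L^∞` terms are `≤ 1.6676 · Γ c e^{−cs}`
  have hE : exp (c * s) - 1 = exp (c * s) * (1 - exp (-(c * s))) := by
    rw [mul_sub, mul_one, ← Real.exp_add, add_neg_cancel, Real.exp_zero]
  have h1e : 0 < 1 - exp (-(c * s)) := by
    have : exp (-(c * s)) < 1 := exp_lt_one_iff.2 (by linarith)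
    linarith
  have hP1 : Γ / ((exp (c * s) - 1) / c) ≤ (63 / 50) ^ 2 * (Γ * c * exp (-(c * s))) := by
    rw [hE, div_div_eq_mul_div]
    have e1 : Γ * c / (exp (c * s) * (1 - exp (-(c * s)))) =
        (1 - exp (-(c * s)))⁻¹ * (Γ * c * exp (-(c * s))) := by
      rw [Real.exp_neg (c * s)]
      field_simp
    rw [e1]
    exact mul_le_mul_of_nonneg_right (inv_one_sub_exp_neg_le hs1) (by positivity)
  have hP2 : Γ / (4 * π * ((exp (c * s) - 1) / c + c⁻¹)) ≤ 0.08 * (Γ * c * exp (-(c * s))) := by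
    rw [clock_add_inv hcpos.ne']
    have e2 : Γ / (4 * π * (exp (c * s) / c)) = (4 * π)⁻¹ * (Γ * c * exp (-(c * s))) := by
      rw [Real.exp_neg]
      field_simp
    rw [e2]
    exact mul_le_mul_of_nonneg_right inv_four_pi_le (by positivity)
  have hP : Γ / ((exp (c * s) - 1) / c) + Γ / (4 * π * ((exp (c * s) - 1) / c + c⁻¹)) ≤
      1.6676 * (Γ * c * exp (-(c * s))) := by
    have : (63 / 50 : ℝ) ^ 2 + 0.08 = 1.6676 := by norm_num
    nlinarith [hP1, hP2, this]
  -- Step 2: monotonicity of the square root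
  have hmono : exp (c * s / 2) * Real.sqrt ((Γ / ((exp (c * s) - 1) / c) +
        Γ / (4 * π * ((exp (c * s) - 1) / c + c⁻¹))) * (Q * exp (-(c * s / 2))) / (2 * π)) ≤
      exp (c * s / 2) * Real.sqrt (1.6676 * (Γ * c * exp (-(c * s))) * (Q * exp (-(c * s / 2))) / (2 * π)) := by
    refine mul_le_mul_of_nonneg_left (Real.sqrt_le_sqrt ?_) (exp_pos _).le
    exact div_le_div_of_nonneg_right (mul_le_mul_of_nonneg_right hP (by positivity)) (by positivity)
  refine hmono.trans ?_
  -- Step 3: the algebra `e^{cs/2} (K Γc e^{−cs} Q e^{−cs/2}/2π)^{1/2} = (K/2π)^{1/2} (Γc)^{1/2} Q^{1/2} e^{−cs/4}`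
  have hsq : 1.6676 * (Γ * c * exp (-(c * s))) * (Q * exp (-(c * s / 2))) / (2 * π) =
      (1.6676 / (2 * π)) * (Γ * c) * Q * exp (-(3 * (c * s) / 4)) ^ 2 := by
    have e3 : exp (-(c * s)) * exp (-(c * s / 2)) = exp (-(3 * (c * s) / 4)) ^ 2 := by
      rw [sq, ← Real.exp_add, ← Real.exp_add]; ring_nf
    calc 1.6676 * (Γ * c * exp (-(c * s))) * (Q * exp (-(c * s / 2))) / (2 * π)
        = (1.6676 / (2 * π)) * (Γ * c) * Q * (exp (-(c * s)) * exp (-(c * s / 2))) := by ring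
      _ = (1.6676 / (2 * π)) * (Γ * c) * Q * exp (-(3 * (c * s) / 4)) ^ 2 := by rw [e3]
  rw [hsq, Real.sqrt_mul' _ (sq_nonneg _), Real.sqrt_sq (exp_pos _).le,
    Real.sqrt_mul (by positivity) Q, Real.sqrt_mul (by positivity) (Γ * c)]
  have hexp : exp (c * s / 2) * exp (-(3 * (c * s) / 4)) = exp (-(c * s / 4)) := by
    rw [← Real.exp_add]; ring_nf
  calc exp (c * s / 2) * (Real.sqrt (1.6676 / (2 * π)) * Real.sqrt (Γ * c) * Real.sqrt Q *
          exp (-(3 * (c * s) / 4)))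
      = Real.sqrt (1.6676 / (2 * π)) * Real.sqrt (Γ * c) * Real.sqrt Q *
          (exp (c * s / 2) * exp (-(3 * (c * s) / 4))) := by ring
    _ = Real.sqrt (1.6676 / (2 * π)) * Real.sqrt (Γ * c) * Real.sqrt Q * exp (-(c * s / 4)) := by
          rw [hexp]
    _ ≤ 0.52 * Real.sqrt (Γ * c) * Real.sqrt Q * exp (-(c * s / 4)) := by
          have hR : 0 ≤ Real.sqrt (Γ * c) * Real.sqrt Q * exp (-(c * s / 4)) := by positivity
          nlinarith [sqrt_const_le, hR]

/-- **THE SPEED-FACE CLOCK AS A NUMBER OF STRAIN TIMES** (same setting; `cs ≥ 1`): for a tolerance `δ` (meaningful for `δ > 0`), once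
`0.52 (2ΓH₀)^{1/4} ≤ δ Γ^{1/2} e^{cs/4}` — i.e. after `s·λA_k ≥ log(0.1462·H₀/Γ) + 4 log(1/δ)` strain-time
units — the child's swirl is within **`δ · Γ (λA_k)^{1/2}`** of the Burgers swirl field at EVERY point of
the cross-section. (`H₀ = Γ`, `δ = 0.005`: `s·λA_k ≥ 19.3`.) [cite: GallayWayne2005, §3.4 ("an explicit
upper bound of the time needed for the solution to enter a given neighborhood of the vortex")] -/
theorem palasekTowerBreakdown_anyProfile_childSwirl_relaxation_threshold (R : TowerRates)
    (k : ℕ) {l : ℝ} (hl : 0 < l) (hS' : Convex ℝ S') (hv : IsClassicalNSSolutionOn S' 1 0 v q)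
    (hω : HasUniformRapidDecayOn S' (fun σ η => PlanarEigenmode.vorticity (v σ) η))
    (hBS : ∀ σ ∈ S', ∀ η, v σ η = biotSavart2D (PlanarEigenmode.vorticity (v σ)) η)
    (hpos : ∀ σ ∈ S', ∀ η, 0 < PlanarEigenmode.vorticity (v σ) η) {L : ℝ} {m : ℕ}
    (hlog : ∀ σ ∈ S', ∀ η, |Real.log (PlanarEigenmode.vorticity (v σ) η)| ≤ L * (1 + ‖η‖) ^ m)
    (hsc : ∀ σ ∈ S', ∀ η, ‖fderiv ℝ (PlanarEigenmode.vorticity (v σ)) η‖ ≤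
      L * (1 + ‖η‖) ^ m * PlanarEigenmode.vorticity (v σ) η)
    (h0 : (0 : ℝ) ∈ S') {s : ℝ} (hs1 : 1 ≤ l * R.A k * s)
    (hτs : (exp (l * R.A k * s) - 1) / (l * R.A k) ∈ S') {δ : ℝ}
    (hclock : 0.52 * Real.sqrt (Real.sqrt (2 * (∫ η, PlanarEigenmode.vorticity (v 0) η) *
          ∫ η, PlanarEigenmode.vorticity (v 0) η *
            Real.log (PlanarEigenmode.vorticity (v 0) η /
              ((∫ y, PlanarEigenmode.vorticity (v 0) y) / (4 * π * (l * R.A k)⁻¹) *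
                exp (-(‖η‖ ^ 2 / (4 * (l * R.A k)⁻¹))))))) ≤
        δ * Real.sqrt (∫ η, PlanarEigenmode.vorticity (v 0) η) * exp (l * R.A k * s / 4))
    (y : EuclideanSpace ℝ (Fin 2)) :
    ‖exp (l * R.A k * s / 2) • v ((exp (l * R.A k * s) - 1) / (l * R.A k)) (exp (l * R.A k * s / 2) • y) -
        biotSavart2D (fun y' => burgersVorticity (l * R.A k) 1
          (∫ η, PlanarEigenmode.vorticity (v 0) η) (embedXY y')) y‖ ≤
      δ * ((∫ η, PlanarEigenmode.vorticity (v 0) η) * Real.sqrt (l * R.A k)) := by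
  set c : ℝ := l * R.A k with hc
  have hcpos : 0 < c := mul_pos hl (R.A_pos k)
  set Γ : ℝ := ∫ η, PlanarEigenmode.vorticity (v 0) η with hΓ
  have hΓ0 : 0 ≤ Γ := integral_nonneg fun η => (hpos 0 h0 η).le
  have h := palasekTowerBreakdown_anyProfile_childSwirl_relaxation_after_one_strain_time R k hl hS' hv
    hω hBS hpos hlog hsc h0 hs1 hτs y
  refine h.trans ?_
  set Q4 : ℝ := Real.sqrt (Real.sqrt (2 * Γ * ∫ η, PlanarEigenmode.vorticity (v 0) η *
    Real.log (PlanarEigenmode.vorticity (v 0) η /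
      (Γ / (4 * π * c⁻¹) * exp (-(‖η‖ ^ 2 / (4 * c⁻¹))))))) with hQ4
  have hee : exp (c * s / 4) * exp (-(c * s / 4)) = 1 := by
    rw [← Real.exp_add, add_neg_cancel, Real.exp_zero]
  have hΓΓ : Real.sqrt Γ * Real.sqrt Γ = Γ := Real.mul_self_sqrt hΓ0
  rw [Real.sqrt_mul hΓ0 c]
  calc 0.52 * (Real.sqrt Γ * Real.sqrt c) * Q4 * exp (-(c * s / 4))
      = (0.52 * Q4) * (Real.sqrt Γ * Real.sqrt c * exp (-(c * s / 4))) := by ring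
    _ ≤ (δ * Real.sqrt Γ * exp (c * s / 4)) * (Real.sqrt Γ * Real.sqrt c * exp (-(c * s / 4))) :=
          mul_le_mul_of_nonneg_right hclock (by positivity)
    _ = δ * (Real.sqrt Γ * Real.sqrt Γ) * Real.sqrt c * (exp (c * s / 4) * exp (-(c * s / 4))) := by ring
    _ = δ * (Γ * Real.sqrt c) := by rw [hee, hΓΓ]; ring

end Summit.NavierStokesRegularity.FluidComputer.PalasekTowerClayBridge
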